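import Summits.QuantumFields.YangMills.Theorems.UnitScaleTiltProp7FlatDeGiorgiStep
import Summits.QuantumFields.YangMills.Theorems.UnitScaleTiltProp7FlatInteriorMeanValue
import HarnessLib

/-!
# Route R of crux K1 «MinimiserStabilityRegPr» (stmt-QuantumFields-19200) — THE SUB-MEAN-VALUE INEQUALITY FOR NONNEGATIVE SUBHARMONIC LATTICE FUNCTIONS:
# `−Δz ≤ 0`, `z ≥ 0` on `Q_R(x₀) ⊂ ℤ^d` ⟹ `z(x₀)² ≤ C_d·R^{−d}·Σ_{Q_R(x₀)} z²`, and its torus reading (file F3 — De Giorgi's dyadic iteration and the brick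
# ★★`sq_le_of_subharmonic_nonneg`; cell `ym3-torus`, width seat `ym-ust-19200-w1` g6; ★★OWNER RULING g26-№20 GO «generic brick»; ★routeR-w1 s2 shape (a);
# `--supports stmt-QuantumFields-19200 --as helper`, count-neutral)

YM₃ on T³ is a RUNG of the ladder (R3), not the Clay problem; nothing here claims the stub, the crux or the gap.

WHY.  Brick 1 (`Prop7FlatInteriorMeanValue.sq_le_of_harmonic`) is the `L² → L^∞` bound for lattice-HARMONIC functions; route R's Kato densities (`‖φ‖_F` of a covariantly
harmonic potential, ✓`Prop7PinnedHarmonicMass`; the (JC′) face non-concentration; the (S3′) `C_reg` input for subharmonic densities) are only SUBharmonic and nonnegative.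
For those the `L² → L^∞` bound is De Giorgi's theorem; this file runs the dyadic iteration of the cell's `Beta.DeGiorgiIteration`∕`SubsolutionMeanValueBox` (unit torus) on
`ℤ^d` boxes, with the step of F2 (`Prop7FlatDeGiorgiStep.step`: truncation + cutoff Caccioppoli + the `ℤ^d` Faber–Krahn inequality), INTEGER radii and levels `k(1 − 2^{−j})`
— no fractional powers (`τ_d := 1∕(21·d·2^{d+1})` is rational; `416d²τ_d² ≤ 2^{−(d+2)}`).

WHAT IS PROVED (sorry-free, no definition; radii `rad_j = R − 2^{m+1} + 2^{m+1−j} − 2j`, levels `lev_j = k(1 − 2^{−j})`, masses `U_j = Σ_{Q_{rad_j}(x₀)} (z − lev_j)₊²`).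
* `tau_contraction` (`416d²τ² ≤ (1/2)^{d+2}`), `rad_succ`, `rad_last_nonneg` (radii bookkeeping under `2^{m+2} ≤ R`).
* ★ `iter` — if `−Δz ≤ 0` on `Q_R(x₀)`, `2^{m+2} ≤ R`, `k > 0` and `U_0 ≤ k²·(τ^d∕16)·2^{md}`, then `U_j ≤ U_0∕2^{j(d+2)}` for all `j ≤ m + 1`.
* ★★ `sq_le_of_subharmonic_nonneg` — `d ≥ 1`, `R ≥ 4`, `z ≥ 0`, `−Δz ≤ 0` (`lop 0 z ≤ 0`) on `Q_R(x₀)` ⟹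
  `z(x₀)² ≤ 16·(336·d·2^d)^d · R^{−d} · Σ_{y ∈ Q_R(x₀)} z(y)²` (termination: `U_{m+1} < (k∕2^{m+2})²`, so no site of the last box exceeds `k`; `m = log₂R − 2`).
* ★★ `sq_le_of_laplace_nonpos_nonneg_torus` — the same on every torus `T^{(j)}` of `Setup`, read through the periodic pullback along `B10Eq27TorusAxialLog.transl x₀`
  (`LatticeFieldCalculus.laplace 1 z (transl x₀ w) ≤ 0` for `w ∈ Q_R(0)`; no period hypothesis; the box is the consumer's «centre-free box»).

HONEST SCOPE.  [folklore] lattice analysis (De Giorgi 1957 in Grigor'yan's Faber–Krahn form; [Giaquinta1984] Ch. III as method pointer); crude constants; flat lattice Laplacian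
only (the covariant case enters through Kato's inequality on the consumer's side).  «Stopping at the brick» (RULING g26-№20): no (JC′)-specific file follows.  Nothing of
Bałaban's is asserted.

References: M. Giaquinta, Princeton UP 1983 [Giaquinta1984] (Ch. III §2); T. Bałaban, CMP 96 (1984) 223–250 [Balaban1984PropagatorsII] ((1.9) p.226).
-/

set_option autoImplicit false

noncomputable section

open scoped BigOperators
open Finset

namespace Summit.QuantumFields.YangMills.Theorems.Prop7FlatSubsolutionMeanValue

open Literature.MathematicalPhysics.QuantumFieldTheory.Balaban1983to89
open B4Eq19LatticeOperators
open LatticeFieldCalculus (laplace)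
open B10Eq27TorusAxialLog (transl transl_zero)
open Summit.QuantumFields.YangMills.Theorems.Prop7FlatDeGiorgiStep (step)
open Summit.QuantumFields.YangMills.Theorems.Prop7FlatInteriorMeanValue (lop_pullback_eq_laplace)

variable {d : ℕ}

/-! ## §1 Constants and the radii bookkeeping -/

/-- **The contraction constant**: with `τ = 1∕(21·d·2^{d+1})` (`d ≥ 1`), `416·d²·τ² ≤ (1/2)^{d+2}`. [folklore] -/
theorem tau_contraction (hd : 1 ≤ d) :
    416 * (d : ℝ) ^ 2 * (1 / (21 * (d : ℝ) * (2 : ℝ) ^ (d + 1))) ^ 2 ≤ (1 / 2 : ℝ) ^ (d + 2) := by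
  have hd1 : (1 : ℝ) ≤ d := by exact_mod_cast hd
  have h2d : (1 : ℝ) ≤ (2 : ℝ) ^ d := one_le_pow₀ (by norm_num)
  have hpos : (0 : ℝ) < 21 * (d : ℝ) * (2 : ℝ) ^ (d + 1) := by positivity
  rw [div_pow, one_pow, one_div_pow, ← div_eq_mul_one_div, div_le_div_iff₀ (by positivity) (by positivity), one_mul]
  have e1 : (21 * (d : ℝ) * (2 : ℝ) ^ (d + 1)) ^ 2 = 441 * (d : ℝ) ^ 2 * ((2 : ℝ) ^ (d + 2) * (2 : ℝ) ^ d) := by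
    rw [show (d + 2 : ℕ) = (d + 1) + 1 by omega]; ring
  rw [e1]
  have : 416 * (d : ℝ) ^ 2 * (2 : ℝ) ^ (d + 2) ≤ 441 * (d : ℝ) ^ 2 * ((2 : ℝ) ^ (d + 2) * (2 : ℝ) ^ d) := by
    have h0 : 0 ≤ (d : ℝ) ^ 2 * (2 : ℝ) ^ (d + 2) := by positivity
    nlinarith
  linarith

/-- Radii bookkeeping: `rad_j − 2^{m−j} − 2 = rad_{j+1}` for `j ≤ m` (`rad_j = R − 2^{m+1} + 2^{m+1−j} − 2j`). [folklore] -/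
theorem rad_succ (R : ℤ) {m j : ℕ} (hj : j ≤ m) :
    (R - 2 ^ (m + 1) + 2 ^ (m + 1 - j) - 2 * (j : ℤ)) - 2 ^ (m - j) - 2 = R - 2 ^ (m + 1) + 2 ^ (m + 1 - (j + 1)) - 2 * ((j + 1 : ℕ) : ℤ) := by
  have e1 : m + 1 - j = (m - j) + 1 := by omega
  have e2 : m + 1 - (j + 1) = m - j := by omega
  rw [e1, e2, pow_succ]
  push_cast
  ring

/-- The last radius is nonnegative when `2^{m+2} ≤ R`: `0 ≤ R − 2^{m+1} + 1 − 2(m+1)`. [folklore] -/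
theorem rad_last_nonneg {R : ℤ} {m : ℕ} (hR : (2 : ℤ) ^ (m + 2) ≤ R) :
    0 ≤ R - 2 ^ (m + 1) + 2 ^ (m + 1 - (m + 1)) - 2 * ((m + 1 : ℕ) : ℤ) := by
  have h1 : (2 * ((m + 1 : ℕ) : ℤ)) ≤ 2 ^ (m + 1) := by
    have : ∀ n : ℕ, 2 * ((n + 1 : ℕ) : ℤ) ≤ 2 ^ (n + 1) := by
      intro n
      induction n with
      | zero => norm_num
      | succ n ih => rw [pow_succ]; push_cast at ih ⊢; nlinarith
    exact this m
  have h2 : (2 : ℤ) ^ (m + 2) = 2 ^ (m + 1) + 2 ^ (m + 1) := by rw [pow_succ]; ring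
  rw [Nat.sub_self, pow_zero]
  linarith

/-! ## §2 The dyadic iteration -/

set_option maxHeartbeats 400000 in
/-- ★ **DE GIORGI'S ITERATION ON `ℤ^d`.**  `d ≥ 1`, `−Δz ≤ 0` on `Q_R(x₀)`, `2^{m+2} ≤ R`, `k > 0`, `τ = 1∕(21d·2^{d+1})`; if the initial mass satisfies
`Σ_{Q_R(x₀)} (z)₊² ≤ k²·(τ^d∕16)·2^{md}`, then along `rad_j = R − 2^{m+1} + 2^{m+1−j} − 2j`, `lev_j = k(1 − 2^{−j})`:
`Σ_{Q_{rad_j}(x₀)} (z − lev_j)₊² ≤ (Σ_{Q_R(x₀)} (z)₊²)∕2^{j(d+2)}` for every `j ≤ m + 1` (each step is F2's `step` with `s = 2^{m−j}`, `δ = k∕2^{j+1}`, `X = τ·2^{m−j}`).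
[folklore] [cite: Giaquinta1984, Ch. III §2 p.78] -/
theorem iter (hd : 1 ≤ d) (z : Zd d → ℝ) (x₀ : Zd d) {R : ℤ} (hz : ∀ y ∈ box x₀ R, lop 0 z y ≤ 0) {m : ℕ} (hR : (2 : ℤ) ^ (m + 2) ≤ R)
    {k : ℝ} (hk : 0 < k)
    (hU0 : ∑ y ∈ box x₀ R, max (z y - 0) 0 ^ 2 ≤ k ^ 2 * ((1 / (21 * (d : ℝ) * (2 : ℝ) ^ (d + 1))) ^ d / 16) * (2 : ℝ) ^ (m * d)) :
    ∀ j : ℕ, j ≤ m + 1 →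
      ∑ y ∈ box x₀ (R - 2 ^ (m + 1) + 2 ^ (m + 1 - j) - 2 * (j : ℤ)), max (z y - k * (1 - (1 / 2 : ℝ) ^ j)) 0 ^ 2 ≤
        (∑ y ∈ box x₀ R, max (z y - 0) 0 ^ 2) / (2 : ℝ) ^ (j * (d + 2)) := by
  set τ : ℝ := 1 / (21 * (d : ℝ) * (2 : ℝ) ^ (d + 1)) with hτ
  set U0 := ∑ y ∈ box x₀ R, max (z y - 0) 0 ^ 2 with hU0def
  have hτ0 : 0 < τ := by rw [hτ]; positivity
  have hcontr := tau_contraction hd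
  rw [← hτ] at hcontr
  have hU0nn : 0 ≤ U0 := Finset.sum_nonneg fun _ _ => sq_nonneg _
  intro j
  induction j with
  | zero =>
    intro _
    have e : R - 2 ^ (m + 1) + 2 ^ (m + 1 - 0) - 2 * ((0 : ℕ) : ℤ) = R := by simp
    rw [e]
    simp only [pow_zero, sub_self, mul_zero, sub_zero, Nat.zero_mul, div_one, hU0def, le_refl]
  | succ j ih =>
    intro hj1
    have hj : j ≤ m := by omega
    obtain ⟨t, ht⟩ := Nat.exists_eq_add_of_le hj
    have ihj := ih (by omega)
    -- the step data
    set ρ : ℤ := R - 2 ^ (m + 1) + 2 ^ (m + 1 - j) - 2 * (j : ℤ) with hρ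
    have hmj : m - j = t := by omega
    set s : ℤ := 2 ^ t with hs
    have hs1 : 1 ≤ s := by rw [hs]; exact one_le_pow₀ (by norm_num)
    have hρs : ρ - s - 2 = R - 2 ^ (m + 1) + 2 ^ (m + 1 - (j + 1)) - 2 * ((j + 1 : ℕ) : ℤ) := by
      rw [hρ, hs, ← hmj]; exact rad_succ R hj
    -- `0 ≤ ρ − s − 2`: the radii decrease to the (nonnegative) last one
    have hρs0 : 0 ≤ ρ - s - 2 := by
      rw [hρs]
      have hlast := rad_last_nonneg hR
      have h1 : (2 : ℤ) ^ (m + 1 - (m + 1)) ≤ 2 ^ (m + 1 - (j + 1)) := pow_le_pow_right₀ (by norm_num) (by omega)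
      have h2 : ((j + 1 : ℕ) : ℤ) ≤ ((m + 1 : ℕ) : ℤ) := by exact_mod_cast (by omega : j + 1 ≤ m + 1)
      linarith
    have hρR : ρ ≤ R := by
      rw [hρ]
      have h1 : (2 : ℤ) ^ (m + 1 - j) ≤ 2 ^ (m + 1) := pow_le_pow_right₀ (by norm_num) (by omega)
      have h2 : (0 : ℤ) ≤ 2 * (j : ℤ) := by positivity
      linarith
    -- level increment and the scale `X`
    set δ : ℝ := k / (2 : ℝ) ^ (j + 1) with hδ
    have hδ0 : 0 < δ := by positivity
    set X : ℝ := τ * (2 : ℝ) ^ t with hX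
    have hX0 : 0 ≤ X := by positivity
    have hsR : (s : ℝ) = (2 : ℝ) ^ t := by rw [hs]; push_cast; ring
    -- powers of two: `2^{md}·2^{2j+2} = 4·2^{j(d+2)}·2^{td}` (with `m = j + t`)
    have hpow : (2 : ℝ) ^ (m * d) * (2 : ℝ) ^ (2 * j + 2) = 4 * (2 : ℝ) ^ (j * (d + 2)) * (2 : ℝ) ^ (t * d) := by
      rw [show (4 : ℝ) = 2 ^ 2 by norm_num, ← pow_add, ← pow_add, ← pow_add]
      congr 1
      rw [ht]; ring
    -- the hypothesis `4 U_j / δ² ≤ X^d`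
    have hUj : 4 * (∑ y ∈ box x₀ ρ, max (z y - k * (1 - (1 / 2 : ℝ) ^ j)) 0 ^ 2) / δ ^ 2 ≤ X ^ d := by
      rw [div_le_iff₀ (by positivity)]
      have hδ2 : δ ^ 2 = k ^ 2 / (2 : ℝ) ^ (2 * j + 2) := by
        rw [hδ, div_pow, ← pow_mul, show (j + 1) * 2 = 2 * j + 2 by ring]
      have hXd : X ^ d = τ ^ d * (2 : ℝ) ^ (t * d) := by rw [hX, mul_pow, ← pow_mul]
      rw [hδ2, hXd]
      -- `4 U_j ≤ 4 U0/2^{j(d+2)} ≤ 4 k²(τ^d/16)2^{md}/2^{j(d+2)} = τ^d 2^{td} k²/2^{2j+2}`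
      have h2 : 0 < (2 : ℝ) ^ (j * (d + 2)) := by positivity
      have h3 : 0 < (2 : ℝ) ^ (2 * j + 2) := by positivity
      have hUjle : ∑ y ∈ box x₀ ρ, max (z y - k * (1 - (1 / 2 : ℝ) ^ j)) 0 ^ 2 ≤
          k ^ 2 * (τ ^ d / 16) * (2 : ℝ) ^ (m * d) / (2 : ℝ) ^ (j * (d + 2)) :=
        ihj.trans (div_le_div_of_nonneg_right hU0 h2.le)
      have e : k ^ 2 * (τ ^ d / 16) * (2 : ℝ) ^ (m * d) / (2 : ℝ) ^ (j * (d + 2)) =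
          τ ^ d * (2 : ℝ) ^ (t * d) * (k ^ 2 / (2 : ℝ) ^ (2 * j + 2)) / 4 := by
        rw [div_eq_div_iff h2.ne' (by norm_num : (4 : ℝ) ≠ 0)]
        have := hpow
        field_simp
        nlinarith [this]
      rw [e] at hUjle
      nlinarith [hUjle]
    -- apply the step
    have hstep := step hd z x₀ hz hs1 hρs0 hρR (k * (1 - (1 / 2 : ℝ) ^ j)) hδ0 hX0 hUj
    -- rewrite its left side to `U_{j+1}` and bound its right side
    have hδ' : δ = k * (1 / 2 : ℝ) ^ (j + 1) := by rw [hδ, one_div_pow]; ring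
    have elev : ∀ y, max (z y - k * (1 - (1 / 2 : ℝ) ^ j) - δ) 0 = max (z y - k * (1 - (1 / 2 : ℝ) ^ (j + 1))) 0 := by
      intro y; congr 1; rw [hδ', pow_succ]; ring
    simp only [elev] at hstep
    rw [hρs] at hstep
    refine hstep.trans ?_
    -- `416 d² X² U_j / s² = 416 d² τ² U_j ≤ 2^{-(d+2)} U_j ≤ U0 / 2^{(j+1)(d+2)}`
    have hUjnn : 0 ≤ ∑ y ∈ box x₀ ρ, max (z y - k * (1 - (1 / 2 : ℝ) ^ j)) 0 ^ 2 := Finset.sum_nonneg fun _ _ => sq_nonneg _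
    have hs2 : (s : ℝ) ^ 2 = ((2 : ℝ) ^ t) ^ 2 := by rw [hsR]
    have hspos : 0 < ((2 : ℝ) ^ t) ^ 2 := by positivity
    have e3 : 416 * (d : ℝ) ^ 2 * X ^ 2 * (∑ y ∈ box x₀ ρ, max (z y - k * (1 - (1 / 2 : ℝ) ^ j)) 0 ^ 2) / (s : ℝ) ^ 2 =
        (416 * (d : ℝ) ^ 2 * τ ^ 2) * (∑ y ∈ box x₀ ρ, max (z y - k * (1 - (1 / 2 : ℝ) ^ j)) 0 ^ 2) := by
      rw [hs2, hX, mul_pow, div_eq_iff hspos.ne']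
      ring
    rw [e3]
    have e4 : U0 / (2 : ℝ) ^ ((j + 1) * (d + 2)) = (1 / 2 : ℝ) ^ (d + 2) * (U0 / (2 : ℝ) ^ (j * (d + 2))) := by
      rw [one_div_pow, show (j + 1) * (d + 2) = j * (d + 2) + (d + 2) by ring, pow_add]
      field_simp
    rw [e4]
    exact mul_le_mul hcontr ihj hUjnn (by positivity)

/-! ## §3 The sub-mean-value inequality -/

set_option maxHeartbeats 400000 in
/-- ★★ **THE SUB-MEAN-VALUE INEQUALITY FOR NONNEGATIVE SUBHARMONIC LATTICE FUNCTIONS ON `ℤ^d`.**  `d ≥ 1`, `R ≥ 4`; if `z ≥ 0` and `−Δz ≤ 0` (`lop 0 z y ≤ 0`,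
i.e. `2d·z(y) ≤ Σ_μ (z(y+e_μ) + z(y−e_μ))`) at every site of `Q_R(x₀)`, then `z(x₀)² ≤ 16·(336·d·2^d)^d·R^{−d}·Σ_{y ∈ Q_R(x₀)} z(y)²` — brick 1's shape with «harmonic»
weakened to «subharmonic, nonnegative» (De Giorgi: `iter` with `m = log₂R − 2`, `k² = 16·Σz²∕(τ^d 2^{md})`; the last truncated mass is `< (k∕2^{m+2})²`, so `z(x₀) < k`).
[folklore] [cite: Giaquinta1984, Ch. III §2 (2.5) p.78; Balaban1984PropagatorsII, (1.9) p.226] -/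
theorem sq_le_of_subharmonic_nonneg (hd : 1 ≤ d) (z : Zd d → ℝ) (hz0 : ∀ y, 0 ≤ z y) (x₀ : Zd d) {R : ℤ} (hR : 4 ≤ R)
    (hz : ∀ y ∈ box x₀ R, lop 0 z y ≤ 0) :
    z x₀ ^ 2 ≤ 16 * (336 * (d : ℝ) * (2 : ℝ) ^ d) ^ d / (R : ℝ) ^ d * ∑ y ∈ box x₀ R, z y ^ 2 := by
  classical
  set τ : ℝ := 1 / (21 * (d : ℝ) * (2 : ℝ) ^ (d + 1)) with hτ
  have hτ0 : 0 < τ := by rw [hτ]; positivity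
  have hτ1 : τ < 1 := by
    rw [hτ, div_lt_one (by positivity)]
    have h1 : (1 : ℝ) ≤ d := by exact_mod_cast hd
    have h2 : (2 : ℝ) ≤ (2 : ℝ) ^ (d + 1) := by
      calc (2 : ℝ) = 2 ^ 1 := (pow_one _).symm
        _ ≤ 2 ^ (d + 1) := pow_le_pow_right₀ (by norm_num) (by omega)
    nlinarith
  have hτd1 : τ ^ d < 1 := pow_lt_one₀ hτ0.le hτ1 (by omega)
  -- the dyadic depth `m = log₂ R − 2`
  set n : ℕ := Nat.log 2 R.toNat with hn
  have hRnat : ((R.toNat : ℕ) : ℤ) = R := Int.toNat_of_nonneg (by linarith)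
  have hn2 : 2 ≤ n := by
    rw [hn]
    have : 2 ^ 2 ≤ R.toNat := by
      have : (4 : ℤ) ≤ (R.toNat : ℤ) := by rw [hRnat]; exact hR
      exact_mod_cast this
    exact Nat.le_log_of_pow_le (by norm_num) this
  set m : ℕ := n - 2 with hm
  have hmR : (2 : ℤ) ^ (m + 2) ≤ R := by
    have h1 : 2 ^ n ≤ R.toNat := Nat.pow_log_le_self 2 (by
      intro h0; have : (R.toNat : ℤ) = 0 := by exact_mod_cast h0
      linarith)
    have : m + 2 = n := by omega
    rw [this, ← hRnat]; exact_mod_cast h1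
  have hRm : (R : ℝ) < (2 : ℝ) ^ (m + 3) := by
    have h1 : R.toNat < 2 ^ (n + 1) := Nat.lt_pow_succ_log_self (by norm_num) _
    have : m + 3 = n + 1 := by omega
    rw [this]
    have h2 : (R : ℤ) < 2 ^ (n + 1) := by rw [← hRnat]; exact_mod_cast h1
    exact_mod_cast h2
  -- the initial mass
  set U0 := ∑ y ∈ box x₀ R, max (z y - 0) 0 ^ 2 with hU0def
  have hU0eq : U0 = ∑ y ∈ box x₀ R, z y ^ 2 := by
    refine Finset.sum_congr rfl fun y _ => ?_
    rw [sub_zero, max_eq_left (hz0 y)]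
  have hU0nn : 0 ≤ U0 := Finset.sum_nonneg fun _ _ => sq_nonneg _
  have hx₀ : x₀ ∈ box x₀ R := self_mem_box x₀ (by linarith)
  have hR0 : (0 : ℝ) < R := by exact_mod_cast (show (0 : ℤ) < R by linarith)
  -- the constant: `16·(336 d 2^d)^d / R^d = 16·8^d / (τ^d R^d)`
  have hconst : 16 * (336 * (d : ℝ) * (2 : ℝ) ^ d) ^ d / (R : ℝ) ^ d = 16 * (8 : ℝ) ^ d / (τ ^ d * (R : ℝ) ^ d) := by
    have e1 : (336 * (d : ℝ) * (2 : ℝ) ^ d) = 8 * (21 * (d : ℝ) * (2 : ℝ) ^ (d + 1)) := by rw [pow_succ]; ring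
    have hq : (0 : ℝ) < (21 * (d : ℝ) * (2 : ℝ) ^ (d + 1)) ^ d := by positivity
    rw [e1, mul_pow, hτ, div_pow, one_pow]
    field_simp
  have hCpos : 0 < 16 * (336 * (d : ℝ) * (2 : ℝ) ^ d) ^ d / (R : ℝ) ^ d := by positivity
  rcases eq_or_lt_of_le hU0nn with hU00 | hU0pos
  · -- `U0 = 0`: `z` vanishes on the box
    have hz00 : z x₀ ^ 2 = 0 := by
      have : z x₀ ^ 2 ≤ U0 := by
        rw [hU0eq]; exact Finset.single_le_sum (f := fun y => z y ^ 2) (fun _ _ => sq_nonneg _) hx₀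
      nlinarith [sq_nonneg (z x₀)]
    rw [hz00]
    exact mul_nonneg hCpos.le (Finset.sum_nonneg fun _ _ => sq_nonneg _)
  · -- `U0 > 0`: the level `k` with `U0 = k²·(τ^d/16)·2^{md}`
    set θ : ℝ := τ ^ d / 16 * (2 : ℝ) ^ (m * d) with hθ
    have hθ0 : 0 < θ := by rw [hθ]; positivity
    set k : ℝ := Real.sqrt (U0 / θ) with hk
    have hk0 : 0 < k := Real.sqrt_pos.mpr (div_pos hU0pos hθ0)
    have hk2 : k ^ 2 = U0 / θ := Real.sq_sqrt (div_pos hU0pos hθ0).le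
    have hU0k : U0 ≤ k ^ 2 * (τ ^ d / 16) * (2 : ℝ) ^ (m * d) := by
      rw [hk2, mul_assoc, ← hθ, div_mul_cancel₀ U0 hθ0.ne']
    have hIt := iter hd z x₀ hz hmR hk0 (by rw [← hτ]; exact hU0k) (m + 1) le_rfl
    -- the last box contains `x₀`
    have hlast0 := rad_last_nonneg hmR
    have hx₀' : x₀ ∈ box x₀ (R - 2 ^ (m + 1) + 2 ^ (m + 1 - (m + 1)) - 2 * ((m + 1 : ℕ) : ℤ)) := self_mem_box x₀ hlast0
    have hpt : max (z x₀ - k * (1 - (1 / 2 : ℝ) ^ (m + 1))) 0 ^ 2 ≤ U0 / (2 : ℝ) ^ ((m + 1) * (d + 2)) :=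
      (Finset.single_le_sum (f := fun y => max (z y - k * (1 - (1 / 2 : ℝ) ^ (m + 1))) 0 ^ 2) (fun _ _ => sq_nonneg _) hx₀').trans hIt
    -- the last mass is below the last increment: `U0 / 2^{(m+1)(d+2)} < (k/2^{m+2})²`
    set q : ℝ := k / (2 : ℝ) ^ (m + 2) with hq
    have hq0 : 0 < q := by positivity
    have hsmall : U0 / (2 : ℝ) ^ ((m + 1) * (d + 2)) < q ^ 2 := by
      -- `q² = k²/2^{2m+4} = U0/(θ 2^{2m+4})` and `θ·2^{2m+4} = τ^d 2^{md+2m} < 2^{(m+1)(d+2)}`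
      have hq2 : q ^ 2 = U0 / (θ * (2 : ℝ) ^ (2 * m + 4)) := by
        rw [hq, div_pow, hk2, ← pow_mul, show (m + 2) * 2 = 2 * m + 4 by ring, div_div]
      rw [hq2, div_lt_div_iff_of_pos_left hU0pos (by positivity) (by positivity)]
      have e : θ * (2 : ℝ) ^ (2 * m + 4) = τ ^ d * (2 : ℝ) ^ (m * d + 2 * m) := by
        have h24 : (2 : ℝ) ^ (2 * m + 4) = (2 : ℝ) ^ (2 * m) * 16 := by rw [pow_add]; norm_num
        have hmd : (2 : ℝ) ^ (m * d + 2 * m) = (2 : ℝ) ^ (m * d) * (2 : ℝ) ^ (2 * m) := pow_add _ _ _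
        rw [hθ, h24, hmd]; ring
      have e2 : (2 : ℝ) ^ ((m + 1) * (d + 2)) = (2 : ℝ) ^ (m * d + 2 * m) * (2 : ℝ) ^ (d + 2) := by
        rw [← pow_add]; congr 1; ring
      rw [e, e2]
      have hP : 0 < (2 : ℝ) ^ (m * d + 2 * m) := by positivity
      have h12 : (1 : ℝ) ≤ (2 : ℝ) ^ (d + 2) := one_le_pow₀ (by norm_num)
      nlinarith
    -- hence `z x₀ < k`
    have hzk : z x₀ < k := by
      have h1 : max (z x₀ - k * (1 - (1 / 2 : ℝ) ^ (m + 1))) 0 ^ 2 < q ^ 2 := lt_of_le_of_lt hpt hsmall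
      have h2 : max (z x₀ - k * (1 - (1 / 2 : ℝ) ^ (m + 1))) 0 < q := by
        nlinarith [le_max_right (z x₀ - k * (1 - (1 / 2 : ℝ) ^ (m + 1))) 0, h1]
      have h3 : z x₀ - k * (1 - (1 / 2 : ℝ) ^ (m + 1)) < q := lt_of_le_of_lt (le_max_left _ _) h2
      have h4 : k * (1 / 2 : ℝ) ^ (m + 1) = 2 * q := by
        rw [hq, one_div_pow, pow_succ]; field_simp; ring
      nlinarith
    -- and `k² ≤ C_d R^{-d} Σ z²`
    have hRd : (R : ℝ) ^ d ≤ (8 : ℝ) ^ d * (2 : ℝ) ^ (m * d) := by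
      have h1 : (R : ℝ) ^ d < ((2 : ℝ) ^ (m + 3)) ^ d := pow_lt_pow_left₀ hRm hR0.le (by omega)
      have e2 : ((2 : ℝ) ^ (m + 3)) ^ d = (8 : ℝ) ^ d * (2 : ℝ) ^ (m * d) := by
        rw [← pow_mul, show ((m + 3) * d : ℕ) = 3 * d + m * d by ring, pow_add, pow_mul]; norm_num
      rw [e2] at h1; exact h1.le
    have hkC : k ^ 2 ≤ 16 * (336 * (d : ℝ) * (2 : ℝ) ^ d) ^ d / (R : ℝ) ^ d * ∑ y ∈ box x₀ R, z y ^ 2 := by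
      rw [hconst, ← hU0eq, hk2, hθ, div_le_iff₀ hθ0]
      have e3 : 16 * (8 : ℝ) ^ d / (τ ^ d * (R : ℝ) ^ d) * U0 * (τ ^ d / 16 * (2 : ℝ) ^ (m * d)) =
          U0 * ((8 : ℝ) ^ d * (2 : ℝ) ^ (m * d) / (R : ℝ) ^ d) := by
        field_simp
      rw [e3]
      have : 1 ≤ (8 : ℝ) ^ d * (2 : ℝ) ^ (m * d) / (R : ℝ) ^ d := by
        rw [le_div_iff₀ (by positivity), one_mul]; exact hRd
      nlinarith
    have hzx0 := hz0 x₀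
    have hzz : z x₀ ^ 2 ≤ k ^ 2 := by nlinarith
    exact hzz.trans hkC

/-- ★★ **THE SUB-MEAN-VALUE INEQUALITY ON THE TORUS `T^{(j)}`**, read through the periodic pullback along `transl x₀ : ℤ^d → Site P j` (no period hypothesis):
`d ≥ 1`, `R ≥ 4`, `z ≥ 0` on the torus, `(laplace 1 z)(transl x₀ w) ≤ 0` for every `w ∈ Q_R(0)` (i.e. `2d·z ≤ Σ` of the `2d` neighbours at those sites — the consumer's
«centre-free box») ⟹ `z(x₀)² ≤ 16·(336·d·2^d)^d·R^{−d}·Σ_{w ∈ Q_R(0)} z(transl x₀ w)²`. [folklore]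
[cite: Giaquinta1984, Ch. III §2 (2.5) p.78; Balaban1984PropagatorsII, (1.9) p.226] -/
theorem sq_le_of_laplace_nonpos_nonneg_torus {P : Params} {j : ℕ} (hd : 1 ≤ P.d) (x₀ : Site P j) (z : Site P j → ℝ) (hz0 : ∀ x, 0 ≤ z x)
    {R : ℤ} (hR : 4 ≤ R) (hz : ∀ w ∈ box (0 : Zd P.d) R, laplace 1 z (transl x₀ w) ≤ 0) :
    z x₀ ^ 2 ≤ 16 * (336 * (P.d : ℝ) * (2 : ℝ) ^ P.d) ^ P.d / (R : ℝ) ^ P.d * ∑ w ∈ box (0 : Zd P.d) R, z (transl x₀ w) ^ 2 := by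
  have h := sq_le_of_subharmonic_nonneg hd (fun w => z (transl x₀ w)) (fun w => hz0 _) 0 hR
    (fun w hw => by rw [lop_pullback_eq_laplace]; exact hz w hw)
  simpa only [transl_zero] using h

end Summit.QuantumFields.YangMills.Theorems.Prop7FlatSubsolutionMeanValue

end
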